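import Literature.Probability.LatticeModels.PointwiseScalingLimitEtaExists
import Literature.Probability.LatticeModels.CriticalFKIsingBoxCrossingLower
import HarnessLib

/-!
# Comparison step for stub `stub_greenComparison` (line `superharmonic-comparison`, crux `TwoPointDoubling`, stmt-CriticalPhenomena-6150)

**The discrete comparison principle at the scales `3k`: no positive effective mass ⟹ `g(6k) ≥ κ₀ g(3k)`.**
Let `G = criticalTwoPoint 3` (the critical plus-state two-point function `⟨σ₀σ_x⟩⁺_{β_c(3)}` of the
nearest-neighbour Ising model on `ℤ³`), `ΔG(x) = Σᵢ (G(x+eᵢ) + G(x−eᵢ)) − 6 G(x)` its six-neighbour lattice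
Laplacian and `g(n) = G(n e₀)`.  Hypothesis (one-sided scale-invariant Kato bound): `ΔG(x) ≤ A·G(x)/‖x‖²` for
every `x ≠ 0`.  Conclusion (`doubling_three_mul_of_kato`): `(sinh 2c/sinh 7c)·g(3k) ≤ g(6k)` for every `k ≥ 1`,
`c = √(π²/2 + max A 0 + 1)`.

Proof (one comparison function, no Harnack inequality).  Fix `k ≥ 1` and the lattice box
`Ω = {k < x₀ < 8k, |x₁| < k, |x₂| < k}`.  The product
`φ(x) = sinh(μ(8k − x₀))·cos(νx₁)·cos(νx₂)/sinh(7kμ)`, `ν = π/(2k)`, `μ = c/k`,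
is an EXACT eigenfunction of the lattice Laplacian (`lattice_laplacian_prod_eigen`),
`Δφ = (2(cosh μ − 1) − 4(1 − cos ν))·φ ≥ (μ² − 2ν²)φ = (A⁺ + 1)k⁻²·φ`, so on `Ω` (where `‖x‖ > k` and `φ > 0`) it
is a STRICT subsolution of `Δ − A⁺/‖x‖²`, while `G` is a supersolution by hypothesis.  On the lattice boundary of
`Ω`, `φ` vanishes on the five far faces (`sinh 0 = 0`, `cos(±π/2) = 0`) and is `≤ 1` on the near face `x₀ = k`,
where `G ≥ g(3k) =: m` by the Messager–Miracle-Solé sandwich (`criticalTwoPoint_axis_sandwich`).  The discrete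
minimum principle (at a negative minimum of `w = G − mφ` over the finite set `Ω` one has `Δw ≥ 0`,
`lattice_laplacian_nonneg_of_le_neighbours`, contradicting the strict inequality `Δw < (A⁺/‖x‖²)·w ≤ 0`) gives
`w ≥ 0` on `Ω`, in particular `g(6k) = G(6k e₀) ≥ m·φ(6k e₀) = g(3k)·sinh(2c)/sinh(7c)`.
The interpolation to every `n` (the registered stub itself) is in the companion file
`…TwoPointDoublingStubGreenComparison.lean`.

Landed from the lead seat of crux stmt-CriticalPhenomena-1981 (line `folded-current-repulsion`, whose registered
stub F2 `stub_wallRepulsion` IS item 6150), as the 6150 strategist census b1 recommends (R1).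

References: M. Aizenman, H. Duminil-Copin, Ann. of Math. 194 (2021), arXiv:1912.07973, Remark 5.10 and §5.6
[AizenmanDuminilCopinAnnals2021]; A. Messager, S. Miracle-Solé, J. Stat. Phys. 17 (1977) [MessagerMiracleSoleJSP1977];
discrete maximum principles in the folklore form "a strict subsolution cannot touch a supersolution from below at an
interior lattice point".
-/

noncomputable section

open Real Finset
open scoped BigOperators
open Literature.Probability.LatticeModels

namespace Summit.CriticalPhenomena.Ising3DConformalLimit.Cruxes.TwoPointDoubling.SuperharmonicComparison


/-! ## Elementary real-variable facts -/

/-- `cosh μ − 1 ≥ μ²/2` (from `cosh μ = 1 + 2 sinh²(μ/2)` and `sinh t ≥ t` for `t ≥ 0`). [folklore] -/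
theorem sq_div_two_le_cosh_sub_one (μ : ℝ) (hμ : 0 ≤ μ) : μ ^ 2 / 2 ≤ Real.cosh μ - 1 := by
  have h1 : Real.cosh μ = 1 + 2 * Real.sinh (μ / 2) ^ 2 := by
    have := Real.cosh_two_mul (μ / 2)
    have h2 := Real.cosh_sq (μ / 2)
    rw [show 2 * (μ / 2) = μ by ring] at this
    nlinarith
  have h3 : μ / 2 ≤ Real.sinh (μ / 2) := Real.self_le_sinh_iff.2 (by linarith)
  have h4 : 0 ≤ μ / 2 := by linarith
  have h5 : (μ / 2) ^ 2 ≤ Real.sinh (μ / 2) ^ 2 := pow_le_pow_left₀ h4 h3 2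
  nlinarith

/-- One-dimensional eigenrelation of `sinh`: `sinh(μ(T − (a+1))) + sinh(μ(T − (a−1))) = 2 cosh μ · sinh(μ(T − a))`.
[folklore] -/
theorem sinh_second_difference (μ T a : ℝ) :
    Real.sinh (μ * (T - (a + 1))) + Real.sinh (μ * (T - (a - 1))) =
      2 * Real.cosh μ * Real.sinh (μ * (T - a)) := by
  rw [show μ * (T - (a + 1)) = μ * (T - a) - μ by ring, show μ * (T - (a - 1)) = μ * (T - a) + μ by ring,
    Real.sinh_sub, Real.sinh_add]
  ring

/-- One-dimensional eigenrelation of `cos`: `cos(ν(b+1)) + cos(ν(b−1)) = 2 cos ν · cos(νb)`. [folklore] -/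
theorem cos_second_difference (ν b : ℝ) :
    Real.cos (ν * (b + 1)) + Real.cos (ν * (b - 1)) = 2 * Real.cos ν * Real.cos (ν * b) := by
  rw [show ν * (b + 1) = ν * b + ν by ring, show ν * (b - 1) = ν * b - ν by ring, Real.cos_add, Real.cos_sub]
  ring

/-! ## The lattice Laplacian: minimum principle input and the product eigenfunction -/

/-- At a point whose value is below its six neighbours' values, the six-neighbour lattice Laplacian is `≥ 0`.
[folklore] -/
theorem lattice_laplacian_nonneg_of_le_neighbours {w : Site 3 → ℝ} {x : Site 3}
    (h : ∀ i : Fin 3, w x ≤ w (x + Pi.single i 1) ∧ w x ≤ w (x - Pi.single i 1)) :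
    0 ≤ (∑ i : Fin 3, (w (x + Pi.single i 1) + w (x - Pi.single i 1))) - 6 * w x := by
  rw [Fin.sum_univ_three]
  obtain ⟨h0, h0'⟩ := h 0
  obtain ⟨h1, h1'⟩ := h 1
  obtain ⟨h2, h2'⟩ := h 2
  linarith

/-- **The product `sinh(μ(T − x₀)) cos(νx₁) cos(νx₂)/N` is an exact eigenfunction of the six-neighbour lattice
Laplacian on `ℤ³`, with eigenvalue `2(cosh μ − 1) − 4(1 − cos ν)`.** [folklore] -/
theorem lattice_laplacian_prod_eigen {μ ν T N : ℝ} {F : Site 3 → ℝ}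
    (hF : ∀ y : Site 3, F y = Real.sinh (μ * (T - y 0)) * Real.cos (ν * y 1) * Real.cos (ν * y 2) / N)
    (x : Site 3) :
    (∑ i : Fin 3, (F (x + Pi.single i 1) + F (x - Pi.single i 1))) - 6 * F x =
      (2 * (Real.cosh μ - 1) - 4 * (1 - Real.cos ν)) * F x := by
  have e0p : F (x + Pi.single 0 1) =
      Real.sinh (μ * (T - ((x 0 : ℝ) + 1))) * Real.cos (ν * x 1) * Real.cos (ν * x 2) / N := by
    rw [hF]; simp
  have e0m : F (x - Pi.single 0 1) =
      Real.sinh (μ * (T - ((x 0 : ℝ) - 1))) * Real.cos (ν * x 1) * Real.cos (ν * x 2) / N := by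
    rw [hF]; simp
  have e1p : F (x + Pi.single 1 1) =
      Real.sinh (μ * (T - x 0)) * Real.cos (ν * ((x 1 : ℝ) + 1)) * Real.cos (ν * x 2) / N := by
    rw [hF]; simp
  have e1m : F (x - Pi.single 1 1) =
      Real.sinh (μ * (T - x 0)) * Real.cos (ν * ((x 1 : ℝ) - 1)) * Real.cos (ν * x 2) / N := by
    rw [hF]; simp
  have e2p : F (x + Pi.single 2 1) =
      Real.sinh (μ * (T - x 0)) * Real.cos (ν * x 1) * Real.cos (ν * ((x 2 : ℝ) + 1)) / N := by
    rw [hF]; simp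
  have e2m : F (x - Pi.single 2 1) =
      Real.sinh (μ * (T - x 0)) * Real.cos (ν * x 1) * Real.cos (ν * ((x 2 : ℝ) - 1)) / N := by
    rw [hF]; simp
  rw [Fin.sum_univ_three, e0p, e0m, e1p, e1m, e2p, e2m, hF x]
  have h0 := sinh_second_difference μ T (x 0)
  have h1 := cos_second_difference ν (x 1)
  have h2 := cos_second_difference ν (x 2)
  linear_combination (Real.cos (ν * x 1) * Real.cos (ν * x 2) / N) * h0 +
    (Real.sinh (μ * (T - x 0)) * Real.cos (ν * x 2) / N) * h1 +
    (Real.sinh (μ * (T - x 0)) * Real.cos (ν * x 1) / N) * h2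

/-! ## The comparison argument at the scales `n = 3k` -/

/-- **Comparison step.** Under the one-sided Kato bound `ΔG(x) ≤ A G(x)/‖x‖²` (`x ≠ 0`), for every `k ≥ 1`,
`(sinh 2c / sinh 7c) · g(3k) ≤ g(6k)` with `c = √(π²/2 + max A 0 + 1)`: minimum principle for `Δ − A⁺/‖x‖²`
on the box `{k < x₀ < 8k, |x₁| < k, |x₂| < k}` against the strict subsolution
`sinh(μ(8k − x₀)) cos(πx₁/2k) cos(πx₂/2k)`, `μ = c/k`, with the MMS sandwich on the near face.
[cite: AizenmanDuminilCopinAnnals2021, arXiv:1912.07973 Remark 5.10] [cite: MessagerMiracleSoleJSP1977, main theorem] -/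
theorem doubling_three_mul_of_kato {A : ℝ}
    (hA : ∀ x : Site 3, x ≠ 0 →
      (∑ i : Fin 3, (criticalTwoPoint 3 (x + Pi.single i 1) + criticalTwoPoint 3 (x - Pi.single i 1))) -
        6 * criticalTwoPoint 3 x ≤ A * criticalTwoPoint 3 x / ‖x‖ ^ 2)
    {k : ℕ} (hk : 1 ≤ k) :
    Real.sinh (2 * Real.sqrt (π ^ 2 / 2 + max A 0 + 1)) / Real.sinh (7 * Real.sqrt (π ^ 2 / 2 + max A 0 + 1)) *
        criticalTwoPoint 3 (Pi.single 0 ((3 * k : ℕ) : ℤ)) ≤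
      criticalTwoPoint 3 (Pi.single 0 ((6 * k : ℕ) : ℤ)) := by
  -- constants
  set A' : ℝ := max A 0 with hA'def
  have hA'0 : 0 ≤ A' := le_max_right _ _
  have hAA' : A ≤ A' := le_max_left _ _
  set c : ℝ := Real.sqrt (π ^ 2 / 2 + A' + 1) with hcdef
  have hc2 : c ^ 2 = π ^ 2 / 2 + A' + 1 := Real.sq_sqrt (by positivity)
  have hcpos : 0 < c := Real.sqrt_pos.2 (by positivity)
  have hkpos : (0 : ℝ) < k := by exact_mod_cast hk
  set K : ℤ := (k : ℤ) with hKdef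
  have hK1 : 1 ≤ K := by rw [hKdef]; exact_mod_cast hk
  set μ : ℝ := c / k with hμdef
  set ν : ℝ := π / (2 * k) with hνdef
  have hμpos : 0 < μ := div_pos hcpos hkpos
  have hνpos : 0 < ν := by rw [hνdef]; positivity
  set N : ℝ := Real.sinh (7 * c) with hNdef
  have hNpos : 0 < N := Real.sinh_pos_iff.2 (by positivity)
  -- the two-point function and the comparison function
  set G : Site 3 → ℝ := fun y => criticalTwoPoint 3 y with hGdef
  have hGpos : ∀ y, 0 < G y := fun y => criticalTwoPoint_pos_of_three_le le_rfl y
  set φ : Site 3 → ℝ := fun y =>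
    Real.sinh (μ * (8 * k - y 0)) * Real.cos (ν * y 1) * Real.cos (ν * y 2) / N with hφdef
  have hφ : ∀ y : Site 3, φ y = Real.sinh (μ * ((8 * k : ℝ) - y 0)) * Real.cos (ν * y 1) * Real.cos (ν * y 2) / N :=
    fun y => rfl
  set m : ℝ := criticalTwoPoint 3 (Pi.single 0 ((3 * k : ℕ) : ℤ)) with hmdef
  have hmpos : 0 < m := criticalTwoPoint_axis_pos (3 * k)
  set w : Site 3 → ℝ := fun y => G y - m * φ y with hwdef
  -- the box
  set t : Fin 3 → Finset ℤ := fun i => if i = 0 then Finset.Icc (K + 1) (8 * K - 1) else Finset.Icc (1 - K) (K - 1)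
    with htdef
  set Ω : Finset (Site 3) := Fintype.piFinset t with hΩdef
  have memΩ : ∀ y : Site 3, y ∈ Ω ↔
      (K + 1 ≤ y 0 ∧ y 0 ≤ 8 * K - 1) ∧ (1 - K ≤ y 1 ∧ y 1 ≤ K - 1) ∧ (1 - K ≤ y 2 ∧ y 2 ≤ K - 1) := by
    intro y
    rw [hΩdef, Fintype.mem_piFinset]
    constructor
    · intro h
      have h0 := h 0
      have h1 := h 1
      have h2 := h 2
      simp only [htdef, if_pos rfl, Finset.mem_Icc] at h0
      simp only [htdef, show (1 : Fin 3) ≠ 0 by decide, if_false, Finset.mem_Icc] at h1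
      simp only [htdef, show (2 : Fin 3) ≠ 0 by decide, if_false, Finset.mem_Icc] at h2
      exact ⟨h0, h1, h2⟩
    · rintro ⟨h0, h1, h2⟩ i
      fin_cases i
      · simpa [htdef] using h0
      · simpa [htdef] using h1
      · simpa [htdef] using h2
  -- cosine facts
  have hνK : ν * k = π / 2 := by rw [hνdef]; field_simp
  have hcos_pos : ∀ z : ℤ, 1 - K ≤ z → z ≤ K - 1 → 0 < Real.cos (ν * z) := by
    intro z hz1 hz2
    apply Real.cos_pos_of_mem_Ioo
    have hz1' : (1 : ℝ) - k ≤ z := by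
      have : ((1 - K : ℤ) : ℝ) ≤ z := by exact_mod_cast hz1
      push_cast [hKdef] at this; linarith
    have hz2' : (z : ℝ) ≤ k - 1 := by
      have : (z : ℝ) ≤ ((K - 1 : ℤ) : ℝ) := by exact_mod_cast hz2
      push_cast [hKdef] at this; linarith
    constructor
    · have : ν * ((1 : ℝ) - k) ≤ ν * z := mul_le_mul_of_nonneg_left hz1' hνpos.le
      have e : ν * ((1 : ℝ) - k) = ν - π / 2 := by rw [mul_sub, hνK]; ring
      linarith
    · have : ν * (z : ℝ) ≤ ν * (k - 1) := mul_le_mul_of_nonneg_left hz2' hνpos.le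
      have e : ν * ((k : ℝ) - 1) = π / 2 - ν := by rw [mul_sub, hνK]; ring
      linarith
  have hcos_K : Real.cos (ν * (K : ℤ)) = 0 := by
    have : ((K : ℤ) : ℝ) = k := by rw [hKdef]; push_cast; ring
    rw [this, hνK, Real.cos_pi_div_two]
  have hcos_negK : Real.cos (ν * ((-K : ℤ) : ℝ)) = 0 := by
    have : ((-K : ℤ) : ℝ) = -k := by rw [hKdef]; push_cast; ring
    rw [this, mul_neg, Real.cos_neg, hνK, Real.cos_pi_div_two]
  -- the boundary estimate: on the lattice boundary of Ω, m φ ≤ G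
  have hbdry : ∀ y : Site 3, (K ≤ y 0 ∧ y 0 ≤ 8 * K) → (-K ≤ y 1 ∧ y 1 ≤ K) → (-K ≤ y 2 ∧ y 2 ≤ K) →
      y ∉ Ω → m * φ y ≤ G y := by
    intro y hy0 hy1 hy2 hout
    rw [memΩ] at hout
    have hcase : y 0 = 8 * K ∨ y 1 = K ∨ y 1 = -K ∨ y 2 = K ∨ y 2 = -K ∨
        (y 0 = K ∧ (1 - K ≤ y 1 ∧ y 1 ≤ K - 1) ∧ (1 - K ≤ y 2 ∧ y 2 ≤ K - 1)) := by omega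
    rcases hcase with h | h | h | h | h | ⟨h0, h1, h2⟩
    · -- far face x₀ = 8k : φ = 0
      have : φ y = 0 := by
        rw [hφ y, h]
        have : μ * ((8 * k : ℝ) - ((8 * K : ℤ) : ℝ)) = 0 := by rw [hKdef]; push_cast; ring
        rw [this, Real.sinh_zero]; simp
      rw [this, mul_zero]; exact (hGpos y).le
    · have : φ y = 0 := by rw [hφ y, h, hcos_K]; simp
      rw [this, mul_zero]; exact (hGpos y).le
    · have : φ y = 0 := by rw [hφ y, h, hcos_negK]; simp
      rw [this, mul_zero]; exact (hGpos y).le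
    · have : φ y = 0 := by rw [hφ y, h, hcos_K]; simp
      rw [this, mul_zero]; exact (hGpos y).le
    · have : φ y = 0 := by rw [hφ y, h, hcos_negK]; simp
      rw [this, mul_zero]; exact (hGpos y).le
    · -- near face x₀ = k : φ ≤ 1 and G ≥ g(3k) = m
      have hsinh : Real.sinh (μ * ((8 * k : ℝ) - ((y 0 : ℤ) : ℝ))) = N := by
        rw [h0, hNdef]
        congr 1
        rw [hKdef, hμdef]; push_cast; field_simp; ring
      have hφle : φ y ≤ 1 := by
        rw [hφ y, hsinh]
        have c1 := Real.cos_le_one (ν * y 1)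
        have c2 := Real.cos_le_one (ν * y 2)
        have c1p := hcos_pos (y 1) h1.1 h1.2
        have c2p := hcos_pos (y 2) h2.1 h2.2
        rw [div_le_one hNpos]
        calc N * Real.cos (ν * y 1) * Real.cos (ν * y 2) ≤ N * 1 * 1 := by
              apply mul_le_mul (mul_le_mul_of_nonneg_left c1 hNpos.le) c2 c2p.le (by positivity)
          _ = N := by ring
      have hsup : Site.supNorm y = k := by
        apply le_antisymm
        · apply Finset.sup_le
          intro i _
          fin_cases i <;> simp <;> omega
        · have := Site.natAbs_le_supNorm y 0
          have e : (y 0).natAbs = k := by rw [h0, hKdef]; simp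
          omega
      have hsand := (criticalTwoPoint_axis_sandwich (y := y) (by omega)).1
      rw [hsup] at hsand
      calc m * φ y ≤ m * 1 := mul_le_mul_of_nonneg_left hφle hmpos.le
        _ = m := mul_one m
        _ ≤ G y := hsand
  -- the minimum principle: w ≥ 0 on Ω
  have hmain : ∀ y ∈ Ω, 0 ≤ w y := by
    by_contra hneg
    push Not at hneg
    obtain ⟨y₁, hy₁, hwy₁⟩ := hneg
    obtain ⟨x₀, hx₀, hmin⟩ := Ω.exists_min_image w ⟨y₁, hy₁⟩
    have hw0 : w x₀ < 0 := (hmin y₁ hy₁).trans_lt hwy₁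
    obtain ⟨⟨h00, h01⟩, ⟨h10, h11⟩, ⟨h20, h21⟩⟩ := (memΩ x₀).1 hx₀
    -- every neighbour value is ≥ w x₀
    have hnb : ∀ i : Fin 3, w x₀ ≤ w (x₀ + Pi.single i 1) ∧ w x₀ ≤ w (x₀ - Pi.single i 1) := by
      intro i
      refine ⟨?_, ?_⟩
      · by_cases hin : x₀ + Pi.single i 1 ∈ Ω
        · exact hmin _ hin
        · have hb : m * φ (x₀ + Pi.single i 1) ≤ G (x₀ + Pi.single i 1) := by
            refine hbdry _ ?_ ?_ ?_ hin
            all_goals fin_cases i <;> simp <;> omega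
          have : 0 ≤ w (x₀ + Pi.single i 1) := by simp only [hwdef]; linarith
          exact hw0.le.trans this
      · by_cases hin : x₀ - Pi.single i 1 ∈ Ω
        · exact hmin _ hin
        · have hb : m * φ (x₀ - Pi.single i 1) ≤ G (x₀ - Pi.single i 1) := by
            refine hbdry _ ?_ ?_ ?_ hin
            all_goals fin_cases i <;> simp <;> omega
          have : 0 ≤ w (x₀ - Pi.single i 1) := by simp only [hwdef]; linarith
          exact hw0.le.trans this
    have hlapw : 0 ≤ (∑ i : Fin 3, (w (x₀ + Pi.single i 1) + w (x₀ - Pi.single i 1))) - 6 * w x₀ :=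
      lattice_laplacian_nonneg_of_le_neighbours hnb
    -- linearity of the Laplacian
    have hlin : (∑ i : Fin 3, (w (x₀ + Pi.single i 1) + w (x₀ - Pi.single i 1))) - 6 * w x₀ =
        ((∑ i : Fin 3, (G (x₀ + Pi.single i 1) + G (x₀ - Pi.single i 1))) - 6 * G x₀) -
          m * ((∑ i : Fin 3, (φ (x₀ + Pi.single i 1) + φ (x₀ - Pi.single i 1))) - 6 * φ x₀) := by
      simp only [hwdef, Fin.sum_univ_three]
      ring
    -- the eigenrelation of φ
    set lam : ℝ := 2 * (Real.cosh μ - 1) - 4 * (1 - Real.cos ν) with hlamdef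
    have hlapφ : (∑ i : Fin 3, (φ (x₀ + Pi.single i 1) + φ (x₀ - Pi.single i 1))) - 6 * φ x₀ = lam * φ x₀ :=
      lattice_laplacian_prod_eigen hφ x₀
    -- the hypothesis at x₀
    have hx₀ne : x₀ ≠ 0 := by
      intro h
      rw [h] at h00
      simp at h00
      omega
    have hlapG := hA x₀ hx₀ne
    -- the potential V = A⁺/‖x₀‖² and the key inequalities
    have hnorm : (k : ℝ) ≤ ‖x₀‖ := by
      have h1 : ‖x₀ 0‖ ≤ ‖x₀‖ := norm_le_pi_norm x₀ 0
      rw [Int.norm_eq_abs] at h1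
      have h2 : ((x₀ 0 : ℤ) : ℝ) ≤ |((x₀ 0 : ℤ) : ℝ)| := le_abs_self _
      have h3 : (k : ℝ) ≤ ((x₀ 0 : ℤ) : ℝ) := by
        have : ((K + 1 : ℤ) : ℝ) ≤ ((x₀ 0 : ℤ) : ℝ) := by exact_mod_cast h00
        push_cast [hKdef] at this; linarith
      linarith
    have hnorm_pos : 0 < ‖x₀‖ := hkpos.trans_le hnorm
    set V : ℝ := A' / ‖x₀‖ ^ 2 with hVdef
    have hV0 : 0 ≤ V := div_nonneg hA'0 (sq_nonneg _)
    have hGV : (∑ i : Fin 3, (G (x₀ + Pi.single i 1) + G (x₀ - Pi.single i 1))) - 6 * G x₀ ≤ V * G x₀ := by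
      have h1 : A * criticalTwoPoint 3 x₀ / ‖x₀‖ ^ 2 ≤ A' * criticalTwoPoint 3 x₀ / ‖x₀‖ ^ 2 :=
        div_le_div_of_nonneg_right (mul_le_mul_of_nonneg_right hAA' (hGpos x₀).le) (sq_nonneg _)
      have h2 : A' * criticalTwoPoint 3 x₀ / ‖x₀‖ ^ 2 = V * G x₀ := by rw [hVdef]; ring
      simpa [hGdef] using (hlapG.trans h1).trans_eq h2
    have hVle : V ≤ A' / (k : ℝ) ^ 2 :=
      div_le_div_of_nonneg_left hA'0 (by positivity) (pow_le_pow_left₀ hkpos.le hnorm 2)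
    have hlam : (A' + 1) / (k : ℝ) ^ 2 ≤ lam := by
      have h1 := sq_div_two_le_cosh_sub_one μ hμpos.le
      have h2 : 1 - ν ^ 2 / 2 ≤ Real.cos ν := Real.one_sub_sq_div_two_le_cos
      have h3 : μ ^ 2 - 2 * ν ^ 2 = (A' + 1) / (k : ℝ) ^ 2 := by
        rw [hμdef, hνdef, div_pow, div_pow, hc2]
        field_simp
        ring
      rw [hlamdef, ← h3]
      linarith
    have hVlam : V < lam := by
      have : A' / (k : ℝ) ^ 2 < (A' + 1) / (k : ℝ) ^ 2 := div_lt_div_of_pos_right (by linarith) (by positivity)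
      linarith
    -- φ(x₀) > 0
    have hφpos : 0 < φ x₀ := by
      rw [hφ x₀]
      apply div_pos _ hNpos
      have hs : 0 < Real.sinh (μ * ((8 * k : ℝ) - ((x₀ 0 : ℤ) : ℝ))) := by
        apply Real.sinh_pos_iff.2
        apply mul_pos hμpos
        have : ((x₀ 0 : ℤ) : ℝ) ≤ ((8 * K - 1 : ℤ) : ℝ) := by exact_mod_cast h01
        push_cast [hKdef] at this; linarith
      exact mul_pos (mul_pos hs (hcos_pos _ h10 h11)) (hcos_pos _ h20 h21)
    have hprod : m * V * φ x₀ < m * lam * φ x₀ :=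
      mul_lt_mul_of_pos_right (mul_lt_mul_of_pos_left hVlam hmpos) hφpos
    have hVw : V * G x₀ - m * V * φ x₀ ≤ 0 := by
      have : V * (G x₀ - m * φ x₀) ≤ 0 := mul_nonpos_of_nonneg_of_nonpos hV0 (by simpa [hwdef] using hw0.le)
      linarith [this, show V * (G x₀ - m * φ x₀) = V * G x₀ - m * V * φ x₀ by ring]
    -- contradiction
    rw [hlin, hlapφ] at hlapw
    nlinarith [hlapw, hGV, hprod, hVw]
  -- evaluate at the target point 6k e₀
  set xt : Site 3 := Pi.single 0 ((6 * k : ℕ) : ℤ) with hxtdef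
  have hxt : xt ∈ Ω := by
    rw [memΩ]
    refine ⟨⟨?_, ?_⟩, ⟨?_, ?_⟩, ⟨?_, ?_⟩⟩ <;> simp [hxtdef] <;> omega
  have hφt : φ xt = Real.sinh (2 * c) / Real.sinh (7 * c) := by
    rw [hφ xt]
    have e0 : ((xt 0 : ℤ) : ℝ) = 6 * k := by simp [hxtdef]
    have e1 : ((xt 1 : ℤ) : ℝ) = 0 := by simp [hxtdef]
    have e2 : ((xt 2 : ℤ) : ℝ) = 0 := by simp [hxtdef]
    rw [e0, e1, e2, mul_zero, Real.cos_zero, mul_one, mul_one]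
    congr 1
    rw [hμdef]; congr 1; field_simp; ring
  have h := hmain xt hxt
  simp only [hwdef, sub_nonneg, hφt] at h
  -- h : m * (sinh 2c / sinh 7c) ≤ G xt
  calc Real.sinh (2 * c) / Real.sinh (7 * c) * m = m * (Real.sinh (2 * c) / Real.sinh (7 * c)) := by ring
    _ ≤ G xt := h
    _ = criticalTwoPoint 3 (Pi.single 0 ((6 * k : ℕ) : ℤ)) := rfl

end Summit.CriticalPhenomena.Ising3DConformalLimit.Cruxes.TwoPointDoubling.SuperharmonicComparison

end
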